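import Literature.AnabelianGeometry.AbsoluteAnabelian.SlimOfTorallyKummerFaithfulDichotomyProofs
import Literature.AnabelianGeometry.AbsoluteAnabelian.AbsTopIII.FunctionFieldSlimIffProofs
import HarnessLib

/-!
# Slimness of `G_K` for torally Kummer-faithful fields: the cyclotomic dichotomy, part 2
# (the radical engine; consequences for [AbsTopIII] Thm 1.11 (c) = F-0337)

S. Mochizuki, [AbsAnab] Thm 1.1.1 (ii) p. 6 and [AbsTopIII] Thm 1.11 p. 45 conjunct (c) ("`G_k` slim"
for Kummer-faithful `k`; contradicted in print by T. Asayama, arXiv:2601.10298 (2026), Cor 1.5 /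
Rmk 1.6; cell abc-iut FACT-LIST row F-0337 `AbsTopIII.Thm_1_11_slim`, which by
`AbsTopIII.Thm_1_11_slim_iff_base` stands or falls exactly with (c)).  PROOF-ONLY sequel of
`SlimOfTorallyKummerFaithfulDichotomyProofs.lean` (branches (A)/(B) of the cyclotomic dichotomy):

* `isSlimGroup_absoluteGaloisGroup_of_isTorallyKummerFaithful_of_radical` — NEW ENGINE: if `K` is
  torally Kummer-faithful and for every finite subextension `E ⊆ K̄`, every prime `r` and every `c` some
  `a ∈ K^×` has `a^{r^c} ∉ (E^×)^{r^j}` for some `j`, then `Gal(K̄/K)` is slim (no valuation needed);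
* `isSlimGroup_absoluteGaloisGroup_of_isTorallyKummerFaithful_of_hom` — the same from ANY homomorphism
  `v : K^× → G` whose values separate `r`-power towers (`∀ r ∃ a ∀ m>0 ∃ j ∀ y, v(y^{r^j}) ≠ v(a^m)`;
  via the norm `N_{E/K}`), e.g. a valuation whose value group has bounded `r`-denominators for each
  `r` — fields such as `ℚ_p(p^{1/r} : r prime)` carry no homomorphism `K^× → ℤ` at all;
* an `example` re-deriving the tree's `ℤ`-valued engine
  `isSlimGroup_absoluteGaloisGroup_of_isTorallyKummerFaithful` as a special case (the new engine
  subsumes the old; kept as an `example` because the statement is literally the landed one);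
* `AbsTopIII.Thm_1_11_slim_c_of_radical` — conjunct (c) PROVED for every Kummer-faithful field
  outside the "radically divisible" class; `AbsTopIII.exists_radical_of_isTorallyKummerFaithful_of_not_isSlimGroup`
  and `AbsTopIII.exists_isKummerFaithful_radical_of_not_Thm_1_11_slim` — the SIGNATURE of any
  counterexample (Asayama: one exists, non-constructively): for some finite `E₀/K`, prime `r` and `c`,
  EVERY `a ∈ K^×` has `a^{r^c} ∈ (E₀^×)^{r^j}` for EVERY `j`.

HONEST FRAMING: classical Kummer theory; F-0337 stays conditional (its `∀`-form is contradicted in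
print); nothing here bears on [IUTchIII] Cor 3.12; no side taken.  No definitions.
[cite: MochizukiAbsAnab2004, Thm 1.1.1 (ii) p.6] [cite: MochizukiAbsTopIII2015, Thm 1.11 p.45]
[cite: Asayama2026KummerFaithfulFG, Cor 1.5]
-/

noncomputable section

open scoped Classical IntermediateField

namespace Literature.AnabelianGeometry.AbsoluteAnabelian

open Field IntermediateField
open Literature.AlgebraicGeometry.Frobenioids (IsSlimGroup)
open AbsTopIII

universe u


/-! ### The new engine -/

/-- **Slimness from toral Kummer-faithfulness and a radical condition** (the cyclotomic dichotomy).
If `K` is torally Kummer-faithful and, for every finite subextension `E ⊆ K̄` of `K`, every prime `r`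
and every `c`, some `a ∈ K^×` has `a^{r^c} ∉ (E^×)^{r^j}` for some `j`, then `Gal(K̄/K)` is slim
(every open subgroup has trivial centraliser).  Generalises
`isSlimGroup_absoluteGaloisGroup_of_isTorallyKummerFaithful` (no valuation needed).
[cite: MochizukiAbsAnab2004, Thm 1.1.1 (ii) p.6] -/
theorem isSlimGroup_absoluteGaloisGroup_of_isTorallyKummerFaithful_of_radical {K : Type u} [Field K]
    (hK : IsTorallyKummerFaithful K)
    (hrad : ∀ E : IntermediateField K (AlgebraicClosure K), FiniteDimensional K E →
      ∀ r : ℕ, r.Prime → ∀ c : ℕ, ∃ a : K, a ≠ 0 ∧ ∃ j : ℕ,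
        ∀ b : AlgebraicClosure K, b ∈ E →
          b ^ (r ^ j) ≠ algebraMap K (AlgebraicClosure K) a ^ (r ^ c)) :
    IsSlimGroup (absoluteGaloisGroup K) := by
  haveI : CharZero K := hK.charZero
  refine ⟨fun U hU => ?_⟩
  rw [eq_bot_iff]
  intro σ hσ
  rw [Subgroup.mem_centralizer_iff] at hσ
  rw [Subgroup.mem_bot]
  set σ' : AlgebraicClosure K ≃ₐ[K] AlgebraicClosure K :=
    absoluteGaloisGroup.toAlgEquiv K σ with hσ'
  suffices hfix : ∀ x : AlgebraicClosure K, σ' x = x by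
    apply (absoluteGaloisGroup.toAlgEquiv K).injective
    rw [map_one]
    exact AlgEquiv.ext hfix
  obtain ⟨E₀, hE₀fin, hE₀U⟩ := exists_finiteDimensional_fixingSubgroup_comap_eq_of_isOpen U hU
  haveI := hE₀fin
  have hcomm : ∀ τ ∈ E₀.fixingSubgroup, ∀ y : AlgebraicClosure K, τ (σ' y) = σ' (τ y) := by
    intro τ hτ y
    have hτU : (absoluteGaloisGroup.toAlgEquiv K).symm τ ∈ U := by
      rw [← hE₀U]
      exact hτ
    have h := hσ _ hτU
    have h' := congrArg (fun g => absoluteGaloisGroup.toAlgEquiv K g y) h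
    simpa [hσ', AlgEquiv.mul_apply] using h'
  by_cases hmove : ∃ (n : ℕ) (ζ : AlgebraicClosure K), 0 < n ∧ ζ ^ n = 1 ∧ σ' ζ ≠ ζ
  · -- branch (A): contradicts the radical hypothesis at `E₀`
    exfalso
    obtain ⟨r, hr, c, hrc⟩ := exists_prime_forall_mem_pow_eq_pow_of_comm E₀ σ' hcomm hmove
    obtain ⟨a, ha, j, hj⟩ := hrad E₀ hE₀fin r hr c
    obtain ⟨b, hbE, -, hb⟩ := hrc a ha j
    exact hj b hbE hb
  · -- branch (B)
    push Not at hmove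
    exact algEquiv_apply_eq_self_of_comm_of_forall_rootOfUnity hK E₀ σ' hcomm
      (fun n ζ hn hζ => hmove n ζ hn hζ)

/-- **Slimness from toral Kummer-faithfulness and a homomorphism separating `r`-power towers.**  If
`K` is torally Kummer-faithful and `v : K^× → G` is a homomorphism such that for every prime `r` some
`a ∈ K^×` satisfies: for every `m ≥ 1` there is `j` with `v(y^{r^j}) ≠ v(a^m)` for all `y ∈ K^×`, then
`Gal(K̄/K)` is slim.  (The norm `N_{E/K}` carries `b^{r^j} = a^{r^c}` in `E` to
`N(b)^{r^j} = a^{[E:K]·r^c}` in `K`.)  Covers value groups with bounded `r`-denominators for every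
`r` (e.g. `{x : x denominators squarefree}`), where no homomorphism to `ℤ` need exist.
[cite: MochizukiAbsAnab2004, Thm 1.1.1 (ii) p.6] -/
theorem isSlimGroup_absoluteGaloisGroup_of_isTorallyKummerFaithful_of_hom {K : Type u} [Field K]
    {G : Type*} [CommGroup G] (hK : IsTorallyKummerFaithful K) (v : Kˣ →* G)
    (hv : ∀ r : ℕ, r.Prime → ∃ a : Kˣ, ∀ m : ℕ, 0 < m →
      ∃ j : ℕ, ∀ y : Kˣ, v (y ^ (r ^ j)) ≠ v (a ^ m)) :
    IsSlimGroup (absoluteGaloisGroup K) := by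
  haveI : CharZero K := hK.charZero
  refine isSlimGroup_absoluteGaloisGroup_of_isTorallyKummerFaithful_of_radical hK ?_
  intro E hE r hr c
  haveI := hE
  obtain ⟨a, ha⟩ := hv r hr
  set d : ℕ := Module.finrank K E with hddef
  have hd : 0 < d := Module.finrank_pos
  obtain ⟨j, hj⟩ := ha (d * r ^ c) (Nat.mul_pos hd (pow_pos hr.pos _))
  refine ⟨(a : K), a.ne_zero, j, fun b hbE hb => ?_⟩
  -- `b` as a unit of `E`
  set aΩ : AlgebraicClosure K := algebraMap K (AlgebraicClosure K) (a : K) with haΩdef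
  have haΩ0 : aΩ ≠ 0 := by
    rw [haΩdef, map_ne_zero]
    exact a.ne_zero
  have hb0 : b ≠ 0 := by
    rintro rfl
    rw [zero_pow (pow_ne_zero _ hr.ne_zero)] at hb
    exact pow_ne_zero _ haΩ0 hb.symm
  set bM : E := ⟨b, hbE⟩ with hbMdef
  have hbM0 : bM ≠ 0 := fun h => hb0 (congrArg Subtype.val h)
  set aM : E := algebraMap K E (a : K) with haMdef
  have haM0 : aM ≠ 0 := by
    rw [haMdef, map_ne_zero]
    exact a.ne_zero
  set bU : (E : Type u)ˣ := Units.mk0 bM hbM0 with hbUdef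
  set aU : (E : Type u)ˣ := Units.mk0 aM haM0 with haUdef
  have hUeq : bU ^ (r ^ j) = aU ^ (r ^ c) := by
    apply Units.ext
    apply (algebraMap E (AlgebraicClosure K)).injective
    rw [Units.val_pow_eq_pow_val, Units.val_pow_eq_pow_val, map_pow, map_pow, hbUdef, haUdef,
      Units.val_mk0, Units.val_mk0, hbMdef, haMdef]
    change b ^ r ^ j = (algebraMap E (AlgebraicClosure K) (algebraMap K E (a : K))) ^ r ^ c
    rw [← IsScalarTower.algebraMap_apply]
    exact hb
  -- norm down to `K`
  set NU : (E : Type u)ˣ →* Kˣ := Units.map (Algebra.norm K : E →* K) with hNUdef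
  have hNa : NU aU = a ^ d := by
    apply Units.ext
    rw [hNUdef, Units.coe_map, haUdef, Units.val_mk0, haMdef, Units.val_pow_eq_pow_val]
    exact Algebra.norm_algebraMap (a : K)
  have hNeq : NU bU ^ (r ^ j) = a ^ (d * r ^ c) := by
    rw [← map_pow, hUeq, map_pow, hNa, ← pow_mul]
  exact hj (NU bU) (by rw [hNeq])

/- CONSISTENCY CHECK (an `example`, since the statement is — by design — that of the tree's
`isSlimGroup_absoluteGaloisGroup_of_isTorallyKummerFaithful`): the `ℤ`-valued engine is RE-DERIVED from
the cyclotomic dichotomy, i.e. the new engine subsumes the old (`r^j · v(y) = m · v(a₀)` is impossible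
once `r^j > m·|v(a₀)|`). [cite: MochizukiAbsAnab2004, Thm 1.1.1 (ii) p.6] -/
example {K : Type u} [Field K]
    (hK : IsTorallyKummerFaithful K) (v : Kˣ →* Multiplicative ℤ) (a₀ : Kˣ) (ha₀ : v a₀ ≠ 1) :
    IsSlimGroup (absoluteGaloisGroup K) := by
  refine isSlimGroup_absoluteGaloisGroup_of_isTorallyKummerFaithful_of_hom hK v ?_
  intro r hr
  refine ⟨a₀, fun m hm => ?_⟩
  let ν : Kˣ → ℤ := fun y => Multiplicative.toAdd (v y)
  have hνpow : ∀ (y : Kˣ) (k : ℕ), ν (y ^ k) = k * ν y := fun y k => by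
    simp only [ν, map_pow, toAdd_pow, nsmul_eq_mul]
  have hνa₀ : ν a₀ ≠ 0 := by
    intro h
    apply ha₀
    simpa [ν] using congrArg Multiplicative.ofAdd h
  set T : ℕ := m * (ν a₀).natAbs with hTdef
  refine ⟨T, fun y hy => ?_⟩
  have hνeq : ((r ^ T : ℕ) : ℤ) * ν y = (m : ℤ) * ν a₀ := by
    have h := congrArg (fun g => Multiplicative.toAdd g) hy
    have h1 : ν (y ^ r ^ T) = ν (a₀ ^ m) := h
    rwa [hνpow, hνpow] at h1
  -- absolute values: `r ^ T * |ν y| = T`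
  have habs : r ^ T * (ν y).natAbs = T := by
    have h := congrArg Int.natAbs hνeq
    rw [Int.natAbs_mul, Int.natAbs_mul, Int.natAbs_natCast, Int.natAbs_natCast] at h
    rw [h, hTdef]
  have hTpos : 0 < T := Nat.mul_pos hm (Int.natAbs_pos.mpr hνa₀)
  have hνy : 0 < (ν y).natAbs := by
    rcases Nat.eq_zero_or_pos (ν y).natAbs with h | h
    · rw [h, mul_zero] at habs
      omega
    · exact h
  have hle : r ^ T ≤ T := by
    calc r ^ T = r ^ T * 1 := (mul_one _).symm
      _ ≤ r ^ T * (ν y).natAbs := Nat.mul_le_mul_left _ hνy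
      _ = T := habs
  have hlt : T < r ^ T :=
    lt_of_lt_of_le (Nat.lt_two_pow_self) (Nat.pow_le_pow_left hr.two_le T)
  omega

/-! ### Consequences for [AbsTopIII] Thm 1.11 (F-0337) -/

namespace AbsTopIII

/-- **[AbsTopIII] Thm 1.11, conjunct (c), PROVED outside the radically divisible class**: a
Kummer-faithful field `k` such that for every finite subextension `E ⊆ k̄`, prime `r` and `c` some
`a ∈ k^×` has `a^{r^c} ∉ (E^×)^{r^j}` for some `j`, has slim absolute Galois group.
[cite: MochizukiAbsTopIII2015, Thm 1.11 p.45] -/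
theorem Thm_1_11_slim_c_of_radical (k : Type u) [Field k] (hk : IsKummerFaithful k)
    (hrad : ∀ E : IntermediateField k (AlgebraicClosure k), FiniteDimensional k E →
      ∀ r : ℕ, r.Prime → ∀ c : ℕ, ∃ a : k, a ≠ 0 ∧ ∃ j : ℕ,
        ∀ b : AlgebraicClosure k, b ∈ E →
          b ^ (r ^ j) ≠ algebraMap k (AlgebraicClosure k) a ^ (r ^ c)) :
    IsSlimGroup (Field.absoluteGaloisGroup k) :=
  isSlimGroup_absoluteGaloisGroup_of_isTorallyKummerFaithful_of_radical hk.isTorallyKummerFaithful hrad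

/-- **Signature of a counterexample to conjunct (c)**: a torally Kummer-faithful field whose absolute
Galois group is NOT slim is radically divisible — for some finite subextension `E₀ ⊆ k̄`, some prime `r`
and some `c`, EVERY `a ∈ k^×` has `a^{r^c} ∈ (E₀^×)^{r^j}` for EVERY `j`.  (By Asayama 2026, Cor 1.5,
Kummer-faithful fields with abelian `G_k` exist; this is what they must look like.)
[cite: Asayama2026KummerFaithfulFG, Cor 1.5] [cite: MochizukiAbsTopIII2015, Thm 1.11 p.45] -/
theorem exists_radical_of_isTorallyKummerFaithful_of_not_isSlimGroup (k : Type u) [Field k]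
    (hk : IsTorallyKummerFaithful k) (hns : ¬ IsSlimGroup (Field.absoluteGaloisGroup k)) :
    ∃ E : IntermediateField k (AlgebraicClosure k), FiniteDimensional k E ∧
      ∃ r : ℕ, r.Prime ∧ ∃ c : ℕ, ∀ a : k, a ≠ 0 → ∀ j : ℕ,
        ∃ b : AlgebraicClosure k, b ∈ E ∧
          b ^ (r ^ j) = algebraMap k (AlgebraicClosure k) a ^ (r ^ c) := by
  by_contra h
  push Not at h
  exact hns (isSlimGroup_absoluteGaloisGroup_of_isTorallyKummerFaithful_of_radical hk h)

/-- **F-0337 made precise**: if the closed fact `Thm_1_11_slim` fails (as Asayama 2026 shows it does,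
non-constructively), then there is a Kummer-faithful field (in the tree's sense) that is radically
divisible in the above sense — the fact's failure is confined to that class.
[cite: MochizukiAbsTopIII2015, Thm 1.11 p.45] [cite: Asayama2026KummerFaithfulFG, Rmk 1.6] -/
theorem exists_isKummerFaithful_radical_of_not_Thm_1_11_slim (h : ¬ Thm_1_11_slim.{u}) :
    ∃ (k : Type u) (_ : Field k), IsKummerFaithful k ∧
      ∃ E : IntermediateField k (AlgebraicClosure k), FiniteDimensional k E ∧
        ∃ r : ℕ, r.Prime ∧ ∃ c : ℕ, ∀ a : k, a ≠ 0 → ∀ j : ℕ,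
          ∃ b : AlgebraicClosure k, b ∈ E ∧
            b ^ (r ^ j) = algebraMap k (AlgebraicClosure k) a ^ (r ^ c) := by
  rw [Thm_1_11_slim_iff_base] at h
  push Not at h
  obtain ⟨k, _, hk, hns⟩ := h
  exact ⟨k, inferInstance, hk,
    exists_radical_of_isTorallyKummerFaithful_of_not_isSlimGroup k hk.isTorallyKummerFaithful hns⟩

end AbsTopIII

end Literature.AnabelianGeometry.AbsoluteAnabelian
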